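import Summits.ResolutionOfSingularities.ResolutionOfSingularities.Theorems.WildPurityWildSymbolBirthDefs
import HarnessLib

/-!
# `WildSymbol` (stmt-ResolutionOfSingularities-17133), line `birth` — symbol calculus in `G ⧸ N`

Support file for crux #2 of route `ResolutionOfSingularities/WildPurity`
(`Summit.ResolutionOfSingularities.ResolutionOfSingularities.Theses.WildPurity.WildSymbol`), line `birth`
(definitions in `Theorems/WildPurityWildSymbolBirthDefs.lean`: `G K ⧸ N p K` is Kato's symbolic
`H³_p(K)`, `Unr p K T` the subgroup of `T`-integral symbols). The consequences of Kato's seven relation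
shapes that every computation in the symbolic group needs (registered sub-goal `sym_d_add`):

* `sym_add_left`, `sym_mul_mid`, `sym_mul_right`, `sym_diag`, `sym_self_mid` — the relation shapes as
  identities of classes; `sym_zero_left`, `sym_natCast_mul_left`, `p_nsmul_sym` (`p`-torsion),
  `sym_one_mid/right`, `sym_inv_mid/right`, `sym_pow_*`, `sym_zpow_*` (integer powers in the logarithmic
  slots), `sym_antisymm` (`[a,b,c} = −[a,c,b}`, polarised alternation), `sym_pow_p_mid` (a `p`-th power
  in a logarithmic slot kills the symbol);
* the two identities encoding the differential `d` inside the presentation: **`sym_d_add`**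
  (`[x b, b, c} + [x b', b', c} = [x (b+b'), b+b', c}`, i.e. `x·db + x·db' = x·d(b + b')`, derived from
  shape (v) `[b, b, c} = 0` alone) and the unit shift **`sym_shift`** (`[a, b, c} = [a b⁻¹(1+b), 1+b, c}`,
  i.e. `db = d(1 + b)`), which is how a non-unit logarithmic entry is traded for a unit;
* `sym_mem_Unr`, `eq_top_of_forall_sym_mem` (symbols generate), and valuation-subring bookkeeping
  (`inv_mem_of_not_mem_nonunits`, `mul_mem_nonunits`, `one_add_not_mem_nonunits`, …) used by the
  calibration files of the line (`Theorems/WildPurityWildSymbolArcPlaces.lean`).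

No definition is declared (the symbol class is a local notation); nothing concludes the crux.
-/

noncomputable section

-- single-problem summit: the doubled namespace component `ResolutionOfSingularities` is forced
set_option linter.dupNamespace false

namespace Summit.ResolutionOfSingularities.ResolutionOfSingularities.Theorems.WildSymbol.Birth

/-! ## Symbol calculus in `G ⧸ N` (consequences of the seven relation shapes) -/

section Calculus

variable {p : ℕ} {K : Type} [Field K]

set_option quotPrecheck false in
/-- `⟪a, b, c⟫` — the class of the symbol `[a, b, c}` in `G K ⧸ N p K` (local notation). -/
local notation "⟪" a ", " b ", " c "⟫" =>
  (((FreeAbelianGroup.of (((a : K), (b : Kˣ), (c : Kˣ)) : K × Kˣ × Kˣ) : G K)) : G K ⧸ N p K)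

/-- Additivity in the first slot. [cite: Kato1982, §1] -/
theorem sym_add_left (a a' : K) (b c : Kˣ) : ⟪a + a', b, c⟫ = ⟪a, b, c⟫ + ⟪a', b, c⟫ := by
  have h : ((FreeAbelianGroup.of (a + a', b, c) - FreeAbelianGroup.of (a, b, c)
      - FreeAbelianGroup.of (a', b, c) : G K) : G K ⧸ N p K) = 0 :=
    (QuotientAddGroup.eq_zero_iff _).mpr (AddSubgroup.subset_closure (Or.inl ⟨a, a', b, c, rfl⟩))
  rw [QuotientAddGroup.mk_sub, QuotientAddGroup.mk_sub, sub_sub, sub_eq_zero] at h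
  exact h

/-- Multiplicativity in the middle slot. [cite: Kato1982, §1] -/
theorem sym_mul_mid (a : K) (b b' c : Kˣ) : ⟪a, b * b', c⟫ = ⟪a, b, c⟫ + ⟪a, b', c⟫ := by
  have h : ((FreeAbelianGroup.of (a, b * b', c) - FreeAbelianGroup.of (a, b, c)
      - FreeAbelianGroup.of (a, b', c) : G K) : G K ⧸ N p K) = 0 :=
    (QuotientAddGroup.eq_zero_iff _).mpr
      (AddSubgroup.subset_closure (Or.inr (Or.inl ⟨a, b, b', c, rfl⟩)))
  rw [QuotientAddGroup.mk_sub, QuotientAddGroup.mk_sub, sub_sub, sub_eq_zero] at h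
  exact h

/-- Multiplicativity in the last slot. [cite: Kato1982, §1] -/
theorem sym_mul_right (a : K) (b c c' : Kˣ) : ⟪a, b, c * c'⟫ = ⟪a, b, c⟫ + ⟪a, b, c'⟫ := by
  have h : ((FreeAbelianGroup.of (a, b, c * c') - FreeAbelianGroup.of (a, b, c)
      - FreeAbelianGroup.of (a, b, c') : G K) : G K ⧸ N p K) = 0 :=
    (QuotientAddGroup.eq_zero_iff _).mpr
      (AddSubgroup.subset_closure (Or.inr (Or.inr (Or.inl ⟨a, b, c, c', rfl⟩))))
  rw [QuotientAddGroup.mk_sub, QuotientAddGroup.mk_sub, sub_sub, sub_eq_zero] at h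
  exact h

/-- Alternation: `[a, b, b} = 0`. [cite: Kato1982, §1] -/
theorem sym_diag (a : K) (b : Kˣ) : ⟪a, b, b⟫ = 0 :=
  (QuotientAddGroup.eq_zero_iff _).mpr
    (AddSubgroup.subset_closure (Or.inr (Or.inr (Or.inr (Or.inl ⟨a, b, rfl⟩)))))

/-- Exactness in the middle slot: `[b, b, c} = 0` (`db ∧ dlog c = d(b dlog c)`). [cite: BlochKato1986, Lemma 4.2] -/
theorem sym_self_mid (b c : Kˣ) : ⟪(b : K), b, c⟫ = 0 :=
  (QuotientAddGroup.eq_zero_iff _).mpr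
    (AddSubgroup.subset_closure (Or.inr (Or.inr (Or.inr (Or.inr (Or.inl ⟨b, c, rfl⟩))))))

/-- `[0, b, c} = 0`. [folklore] -/
theorem sym_zero_left (b c : Kˣ) : ⟪(0 : K), b, c⟫ = 0 := by
  have h := sym_add_left (p := p) (0 : K) 0 b c
  rw [add_zero] at h
  simpa using h

/-- `[n a, b, c} = n • [a, b, c}`. [folklore] -/
theorem sym_natCast_mul_left (n : ℕ) (a : K) (b c : Kˣ) : ⟪(n : K) * a, b, c⟫ = n • ⟪a, b, c⟫ := by
  induction n with
  | zero => simp [sym_zero_left]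
  | succ n ih => rw [Nat.cast_succ, add_mul, one_mul, sym_add_left, ih, succ_nsmul]

/-- Every symbol is `p`-torsion when `char K = p`. [folklore] -/
theorem p_nsmul_sym [CharP K p] (a : K) (b c : Kˣ) : p • ⟪a, b, c⟫ = 0 := by
  rw [← sym_natCast_mul_left, CharP.cast_eq_zero, zero_mul, sym_zero_left]

/-- `[a, 1, c} = 0`. [folklore] -/
theorem sym_one_mid (a : K) (c : Kˣ) : ⟪a, 1, c⟫ = 0 := by
  have h := sym_mul_mid (p := p) a 1 1 c
  rw [mul_one] at h
  simpa using h

/-- `[a, b, 1} = 0`. [folklore] -/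
theorem sym_one_right (a : K) (b : Kˣ) : ⟪a, b, 1⟫ = 0 := by
  have h := sym_mul_right (p := p) a b 1 1
  rw [mul_one] at h
  simpa using h

/-- `[a, b⁻¹, c} = -[a, b, c}`. [folklore] -/
theorem sym_inv_mid (a : K) (b c : Kˣ) : ⟪a, b⁻¹, c⟫ = -⟪a, b, c⟫ := by
  have h := sym_mul_mid (p := p) a b b⁻¹ c
  rw [mul_inv_cancel, sym_one_mid] at h
  exact eq_neg_of_add_eq_zero_right h.symm

/-- `[a, b, c⁻¹} = -[a, b, c}`. [folklore] -/
theorem sym_inv_right (a : K) (b c : Kˣ) : ⟪a, b, c⁻¹⟫ = -⟪a, b, c⟫ := by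
  have h := sym_mul_right (p := p) a b c c⁻¹
  rw [mul_inv_cancel, sym_one_right] at h
  exact eq_neg_of_add_eq_zero_right h.symm

/-- `[a, bⁿ, c} = n • [a, b, c}`. [folklore] -/
theorem sym_pow_mid (a : K) (b c : Kˣ) (n : ℕ) : ⟪a, b ^ n, c⟫ = n • ⟪a, b, c⟫ := by
  induction n with
  | zero => rw [pow_zero, sym_one_mid, zero_nsmul]
  | succ n ih => rw [pow_succ, sym_mul_mid, ih, succ_nsmul]

/-- `[a, b, cⁿ} = n • [a, b, c}`. [folklore] -/
theorem sym_pow_right (a : K) (b c : Kˣ) (n : ℕ) : ⟪a, b, c ^ n⟫ = n • ⟪a, b, c⟫ := by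
  induction n with
  | zero => rw [pow_zero, sym_one_right, zero_nsmul]
  | succ n ih => rw [pow_succ, sym_mul_right, ih, succ_nsmul]

/-- `[a, bᶻ, c} = z • [a, b, c}` for `z : ℤ`. [folklore] -/
theorem sym_zpow_mid (a : K) (b c : Kˣ) (z : ℤ) : ⟪a, b ^ z, c⟫ = z • ⟪a, b, c⟫ := by
  cases z with
  | ofNat n => rw [Int.ofNat_eq_natCast, zpow_natCast, natCast_zsmul, sym_pow_mid]
  | negSucc n => rw [zpow_negSucc, sym_inv_mid, sym_pow_mid, negSucc_zsmul]

/-- `[a, b, cᶻ} = z • [a, b, c}` for `z : ℤ`. [folklore] -/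
theorem sym_zpow_right (a : K) (b c : Kˣ) (z : ℤ) : ⟪a, b, c ^ z⟫ = z • ⟪a, b, c⟫ := by
  cases z with
  | ofNat n => rw [Int.ofNat_eq_natCast, zpow_natCast, natCast_zsmul, sym_pow_right]
  | negSucc n => rw [zpow_negSucc, sym_inv_right, sym_pow_right, negSucc_zsmul]

/-- Antisymmetry in the two logarithmic slots: `[a, b, c} = -[a, c, b}` (polarise `[a, bc, bc} = 0`).
[folklore] -/
theorem sym_antisymm (a : K) (b c : Kˣ) : ⟪a, b, c⟫ = -⟪a, c, b⟫ := by
  have h := sym_diag (p := p) a (b * c)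
  rw [sym_mul_mid, sym_mul_right, sym_mul_right, sym_diag, sym_diag, zero_add, add_zero] at h
  exact eq_neg_of_add_eq_zero_left h

/-- A `p`-th power in a logarithmic slot kills the symbol (`dlog eᵖ = 0`). [folklore] -/
theorem sym_pow_p_mid [CharP K p] (a : K) (e c : Kˣ) : ⟪a, e ^ p, c⟫ = 0 := by
  rw [sym_pow_mid, p_nsmul_sym]

/-- **Additivity of `d` (the Leibniz shape hidden in the relations).** For units `b, b', s` with
`s = b + b'`: `[x b, b, c} + [x b', b', c} = [x s, s, c}` — i.e. `x·db + x·db' = x·d(b + b')` against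
`dlog c`. Derivation: with `A = x s`, `u = b/s`, `u' = b'/s` (so `u + u' = 1`), shape (v) gives
`[Au, u, c} = −[Au, A, c}` and `[Au', u', c} = −[Au', A, c}`, whose sum is `−[A, A, c} = 0`.
[cite: BlochKato1986, Lemma 4.2] -/
theorem sym_d_add (x : K) (b b' s c : Kˣ) (hs : (s : K) = b + b') : ((FreeAbelianGroup.of (x * (b : K), b, c) : G K) : G K ⧸ N p K) + ((FreeAbelianGroup.of (x * (b' : K), b', c) : G K) : G K ⧸ N p K) = ((FreeAbelianGroup.of (x * (s : K), s, c) : G K) : G K ⧸ N p K) := by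
  by_cases hx : x = 0
  · subst hx
    simp only [zero_mul, sym_zero_left, add_zero]
  obtain ⟨A, hAK⟩ : ∃ A : Kˣ, (A : K) = x * s := ⟨Units.mk0 (x * s) (mul_ne_zero hx s.ne_zero), rfl⟩
  obtain ⟨u, hu⟩ : ∃ u : Kˣ, u = b * s⁻¹ := ⟨_, rfl⟩
  obtain ⟨u', hu'⟩ : ∃ u' : Kˣ, u' = b' * s⁻¹ := ⟨_, rfl⟩
  have hxb : x * (b : K) = (A : K) * (u : K) := by
    rw [hAK, hu, Units.val_mul, Units.val_inv_eq_inv_val]; field_simp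
  have hxb' : x * (b' : K) = (A : K) * (u' : K) := by
    rw [hAK, hu', Units.val_mul, Units.val_inv_eq_inv_val]; field_simp
  have hb : b = u * s := by rw [hu, inv_mul_cancel_right]
  have hb' : b' = u' * s := by rw [hu', inv_mul_cancel_right]
  have hsum : (A : K) * u + (A : K) * u' = A := by
    rw [← mul_add, hu, hu', Units.val_mul, Units.val_mul, Units.val_inv_eq_inv_val, ← add_mul, ← hs,
      mul_inv_cancel₀ s.ne_zero, mul_one]
  have h1 : ⟪(A : K) * u, u, c⟫ = -⟪(A : K) * u, A, c⟫ := by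
    have h := sym_self_mid (p := p) (A * u) c
    rw [Units.val_mul, sym_mul_mid] at h
    exact eq_neg_of_add_eq_zero_right h
  have h2 : ⟪(A : K) * u', u', c⟫ = -⟪(A : K) * u', A, c⟫ := by
    have h := sym_self_mid (p := p) (A * u') c
    rw [Units.val_mul, sym_mul_mid] at h
    exact eq_neg_of_add_eq_zero_right h
  rw [hxb, hxb', hb, hb', sym_mul_mid _ u s, sym_mul_mid _ u' s, h1, h2, ← hAK]
  calc -⟪(A : K) * u, A, c⟫ + ⟪(A : K) * u, s, c⟫ + (-⟪(A : K) * u', A, c⟫ + ⟪(A : K) * u', s, c⟫)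
      = -(⟪(A : K) * u, A, c⟫ + ⟪(A : K) * u', A, c⟫) + (⟪(A : K) * u, s, c⟫ + ⟪(A : K) * u', s, c⟫) := by
        abel
    _ = -⟪(A : K), A, c⟫ + ⟪(A : K), s, c⟫ := by rw [← sym_add_left, ← sym_add_left, hsum]
    _ = ⟪(A : K), s, c⟫ := by rw [sym_self_mid, neg_zero, zero_add]

/-- **The unit shift** (`db = d(1 + b)`): for units `b, t` with `t = 1 + b`,
`[a, b, c} = [a b⁻¹ t, t, c}`. [folklore] -/
theorem sym_shift (a : K) (b t c : Kˣ) (ht : (t : K) = 1 + b) : ⟪a, b, c⟫ = ⟪a * ↑b⁻¹ * t, t, c⟫ := by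
  have h := sym_d_add (p := p) (a * ↑b⁻¹) b 1 t c (by rw [ht, Units.val_one, add_comm])
  rw [Units.inv_mul_cancel_right, sym_one_mid, add_zero] at h
  exact h

/-- An integral symbol lies in `Unr T`. [folklore] -/
theorem sym_mem_Unr {T : Subring K} {a : K} {b c : Kˣ} (ha : a ∈ T) (hb : (b : K) ∈ T)
    (hb' : ((b⁻¹ : Kˣ) : K) ∈ T) (hc : (c : K) ∈ T) (hc' : ((c⁻¹ : Kˣ) : K) ∈ T) :
    ⟪a, b, c⟫ ∈ Unr p K T :=
  AddSubgroup.subset_closure ⟨a, b, c, ha, hb, hb', hc, hc', rfl⟩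

/-- If every symbol class lies in an additive subgroup `U` of `G ⧸ N`, then `U = ⊤`. [folklore] -/
theorem eq_top_of_forall_sym_mem (U : AddSubgroup (G K ⧸ N p K))
    (h : ∀ (a : K) (b c : Kˣ), ⟪a, b, c⟫ ∈ U) : U = ⊤ := by
  have key : ∀ α : G K ⧸ N p K, α ∈ U := by
    intro α
    induction α using QuotientAddGroup.induction_on with
    | H g =>
      induction g using FreeAbelianGroup.induction_on with
      | zero => rw [QuotientAddGroup.mk_zero]; exact U.zero_mem
      | of x => obtain ⟨a, b, c⟩ := x; exact h a b c
      | neg x hx => rw [QuotientAddGroup.mk_neg]; exact U.neg_mem hx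
      | add x y hx hy => rw [QuotientAddGroup.mk_add]; exact U.add_mem hx hy
  exact eq_top_iff.mpr fun α _ => key α

end Calculus

/-! ## Valuation-subring bookkeeping -/

section ValuationLemmas

variable {K : Type} [Field K] (O : ValuationSubring K)

/-- An element outside `O.nonunits` is non-zero. [folklore] -/
theorem ne_zero_of_not_mem_nonunits {w : K} (hw : w ∉ O.nonunits) : w ≠ 0 := by
  rintro rfl
  exact hw O.nonunits.zero_mem

/-- An element outside `O.nonunits` has its inverse in `O`. [folklore] -/
theorem inv_mem_of_not_mem_nonunits {w : K} (hw : w ∉ O.nonunits) : w⁻¹ ∈ O := by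
  rw [ValuationSubring.mem_nonunits_iff_or, not_or, not_not] at hw
  exact hw.2

/-- The inverse of a unit of `O` is again outside `O.nonunits`. [folklore] -/
theorem inv_not_mem_nonunits {w : K} (hwO : w ∈ O) (hw : w ∉ O.nonunits) : w⁻¹ ∉ O.nonunits := by
  rw [ValuationSubring.inv_mem_nonunits_iff, not_or, not_not]
  exact ⟨ne_zero_of_not_mem_nonunits O hw, hwO⟩

/-- A non-unit times an element of `O` is a non-unit. [folklore] -/
theorem mul_mem_nonunits {t x : K} (ht : t ∈ O.nonunits) (hx : x ∈ O) : t * x ∈ O.nonunits := by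
  rw [ValuationSubring.mem_nonunits_iff] at ht ⊢
  rw [map_mul]
  calc O.valuation t * O.valuation x ≤ O.valuation t * 1 := by
        gcongr
        exact (O.valuation_le_one_iff x).mpr hx
    _ = O.valuation t := mul_one _
    _ < 1 := ht

/-- `1 + t` is a unit of `O` for a non-unit `t`. [folklore] -/
theorem one_add_not_mem_nonunits {t : K} (ht : t ∈ O.nonunits) : 1 + t ∉ O.nonunits := by
  rw [ValuationSubring.mem_nonunits_iff] at ht ⊢
  rw [O.valuation.map_one_add_of_lt ht]
  exact lt_irrefl 1

end ValuationLemmas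

end Summit.ResolutionOfSingularities.ResolutionOfSingularities.Theorems.WildSymbol.Birth

end
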